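import Literature.AlgebraicGeometry.Morphisms.SectionsFpqcDescentChart
import Literature.AlgebraicGeometry.Modules.PullbackSectionsBaseChange
import Literature.AlgebraicGeometry.Modules.EquivariantStructureRestrict
import Literature.AlgebraicGeometry.Modules.PullbackQuasicoherent
import Literature.AlgebraicGeometry.RelativeSpec.TorsorQuotientModuleChart
import Literature.AlgebraicGeometry.RelativeSpec.TorsorQuotientModuleChartUnit
import Literature.RingTheory.Flat.ModuleDescentData
import HarnessLib

/-!
# The cocycle of a descent datum on the affine TRIPLE chart of a torsor quotient, and effective descent on one chart
# (wave C organ (ii) Dγ-CHART, PART 2)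

Topic `Literature/AlgebraicGeometry/RelativeSpec`, namespace `Literature.AlgebraicGeometry.RelativeSpec.TorsorQuotient` (= PART 1's,
★ `RelativeSpec/TorsorQuotientModuleChart`).  THEOREMS ONLY; no definition, no named fact, no instance, no notation, no `sorry`.

[SGA1] Exp. VIII Thm. 1.1 / [StacksProject, Tag 023N] / [GortzWedhorn2020] Thm. 14.68 / [MumfordAV1970] §12 Thm. 1 (B) (p. 112): a quasi-coherent
module `E` on `O` with a descent datum `Φ : act^* E ⟶ pr₂^* E` along an fppf torsor quotient `q : O → Q` (kernel pair `act, pr₂ : P ⇉ O`,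
torsor square `P ≅ O ×_Q O`) satisfying the UNIT and COCYCLE conditions of [MumfordFogartyKirwan1994] Ch. 1 §3 Def. 1.6 descends: on every
affine chart `V ⊆ Q` the coinvariant sections `N_V ⊆ Γ(q⁻¹V, E)` satisfy `Γ(q⁻¹V) ⊗_{Γ(V)} N_V ≅ Γ(q⁻¹V, E)`.  PART 1 (★ `TorsorQuotientModuleChart`)
read the degree-one data on the chart `U = q⁻¹V`, `W = act⁻¹U ⊓ pr₂⁻¹U`; ★ `TorsorQuotientModuleChartUnit` read the unit slice; THIS FILE reads the
COCYCLE on the affine TRIPLE chart and assembles the chart theorem: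

* CURRENCY (abstract, as PART 1): `P₃ P O Q : Over S`, `act pr₂ : P ⟶ O`, `q : O ⟶ Q`, and a TRIPLE `e₁₂ e₁₃ e₂₃ : P₃ ⟶ P` (for a group-scheme
  action `P₃ = (G ⊗ G) ⊗ X`, `e₁₃ = μ ▷ X`, `e₁₂ = actRight`, `e₂₃ = proj₂₃` of ★ `Modules/SchemeLinearisation`) with the second torsor square
  `hsq₃ : IsPullback e₁₂ e₂₃ pr₂ act` (★ `GroupSchemes/ActionTripleSquare`), the three faces `h₁ : e₁₃ ≫ act = e₁₂ ≫ act`,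
  `h₂ : e₁₂ ≫ pr₂ = e₂₃ ≫ act`, `h₃ : e₂₃ ≫ pr₂ = e₁₃ ≫ pr₂`, and the COCYCLE in EXACTLY the shape of ★ `Modules.Linearisation.iso_mul_hom`:
  `e₁₃^*Φ = can(h₁) ≫ e₁₂^*Φ ≫ can(h₂) ≫ e₂₃^*Φ ≫ can(h₃)` (`can` = ★ `Modules.squareIso`);
* §0 `squareIso_hom_app_unitSectionLE` — ★ `squareIso_hom_app_unitSection` on RESTRICTED unit sections (the one transport lemma used throughout);
* §1 the triple chart `W₃ = e₁₂⁻¹W ⊓ e₂₃⁻¹W`: the PASTED square `IsPullback (e₂₃ ≫ pr₂) e₁₂ q (pr₂ ≫ q)` (`P₃ ≅ P ×_Q O`), `W₃ ≤ e₁₃⁻¹W`,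
  `W₃ = (e₂₃ ≫ pr₂)⁻¹U ⊓ e₁₂⁻¹W`, `W₃` affine (★ `isAffineOpen_of_isPullback_of_eq_inf`);
* §2 the three cofaces `π₁₂ π₁₃ π₂₃ := e♯ : Γ(W) → Γ(W₃)` and the face identities over the three vertices (`appLE` calculus);
* §3 the transitions `t₂ := η_{e₁₂}(–)|_{W₃}`, `t₃ := η_{e₁₃}(–)|_{W₃}`, `t₃' := can(h₃)(η_{e₂₃}(–)|_{W₃})` of `Γ(W, pr₂^*E)` into
  `Q₂ := Γ(W₃, e₁₂^*pr₂^*E)`, `Q₃ := Γ(W₃, e₁₃^*pr₂^*E)` and the transfer `Φ₂₃ := can(h₂) ≫ e₂₃^*Φ ≫ can(h₃)` — semilinearity;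
* §4 the identities on unit sections `hk₃ : t₃ ∘ j₂ = t₃' ∘ j₂`, `hΦ₂₃ : Φ₂₃ ∘ t₂ ∘ j₂ = t₃' ∘ Φ_W ∘ j₁`; the level-3 base change
  `Γ(W₃, e₁₃^*pr₂^*E) = Γ(W₃) ⊗_{Γ(W)} Γ(W, pr₂^*E)` (★ `isBaseChange_unitSectionLE`); and the TRIPLE RING ISOMORPHISM
  `Γ(U) ⊗_{Γ(V)} Γ(W) ≅ Γ(W₃)` (Mathlib `isIso_pushoutSection_of_isAffineOpen` at the pasted square) — with PART 1's `Γ(W) ≅ Γ(U) ⊗_{Γ(V)} Γ(U)`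
  this is `Γ(W₃) ≅ Γ(U)^{⊗3}` through the three vertex maps;
* §5 **`transition₁₃_coface_eq_of_cocycle`** — THE COCYCLE ON UNIT SECTIONS `t₃ (Φ_W (j₁ x)) = Φ₂₃ (t₂ (Φ_W (j₁ x)))`: the scheme-level cocycle
  evaluated at `η_{e₁₃}(η_act(x)|_W)|_{W₃}`;
* §6 **`isBaseChange_of_range_eq_equaliser`** — THE CHART THEOREM: every row of the «s7 binder block» of ★ `RingTheory/Flat/ModuleDescentData`
  is produced from the scheme data (PART 1 + the unit file + §2–§5) and its head `isBaseChange_of_range_eq_of_isBaseChange` is applied: any injective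
  `Γ(V)`-linear `j : N → Γ(U, E)` whose range is the set of coinvariant sections (★ `SchemeEquivariant.mem_range_moduleCoinvariantsι_app_iff_inf`
  shape) is a base change along `Γ(V) → Γ(U)` — the hypothesis `hbc` of ★ `SchemeEquivariant.descentHom_app_bijective_of_isBaseChange`
  (`RelativeSpec/TorsorQuotientModuleDescent`), in its dress.  The triple chart enters §6 as a binder `W₃` pinned by `hW₃ : W₃ = e₁₂⁻¹W ⊓ e₂₃⁻¹W`
  (consumers pass `rfl`; keeping `W₃` a variable keeps the assembly inside one `set_option maxHeartbeats 400000`, 2× default).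

Cell `hodgecm-mathlib`, P6b wave C of §D `stub_L4B1uD_mumfordLambdaDescent` (organ (ii) PART 2; consumers (iii) ∕ Dδ); count-neutral capital on
`--supports stmt-HodgeConjecture-24832`; HC_CM is proved only modulo the printed citations until rung 0 closes; nothing here is about HC.

## References
* [SGA1] A. Grothendieck, *SGA 1*, Exp. VIII §1, Thm. 1.1.
* [StacksProject] The Stacks Project, Tags 023M, 023N.
* [GortzWedhorn2020] U. Görtz, T. Wedhorn, *Algebraic Geometry I*, 2nd ed. (2020), Prop. 4.16 (pp. 101–104), Prop. 14.66, Thm. 14.68.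
* [MumfordAV1970] D. Mumford, *Abelian Varieties* (1970), §12 Thm. 1 (B) (p. 112) and its proof.
* [MumfordFogartyKirwan1994] D. Mumford, J. Fogarty, F. Kirwan, *Geometric Invariant Theory*, 3rd ed. (1994), Ch. 1 §3 Def. 1.6 (p. 30).
* [Hartshorne1977] R. Hartshorne, *Algebraic Geometry*, GTM 52 (1977), II §5 (p. 110).
-/


noncomputable section

set_option autoImplicit false

-- `TopCat.Presheaf`/`Scheme.Modules` are not reducible (as in Mathlib's `AlgebraicGeometry/Modules` and PART 1).
set_option backward.isDefEq.respectTransparency false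

universe u

open CategoryTheory CategoryTheory.Limits AlgebraicGeometry TopologicalSpace Opposite TensorProduct

namespace Literature.AlgebraicGeometry.RelativeSpec

namespace TorsorQuotient

open Literature.AlgebraicGeometry.Modules Literature.AlgebraicGeometry.Morphisms Literature.RingTheory.Flat

/-! ## §0 Two pieces of unit-section plumbing (general) -/

section Plumbing

variable {S₀ S' X₀ X' : Scheme.{u}} {b : S' ⟶ S₀} {ι : S₀ ⟶ X₀} {ι' : S' ⟶ X'} {a : X' ⟶ X₀}

/-- `η_b(η_ι(m)|_{V₁})|_{W'}` is the restriction of `η_b(η_ι(m))` along any arrow `W' ⟶ b⁻¹ι⁻¹U₀`. [cite: Hartshorne1977, II.5 (p. 110)] -/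
theorem unitSectionLE_unitSectionLE_eq_map (F : X₀.Modules) {U₀ : X₀.Opens} {V₁ : S₀.Opens} {W' : S'.Opens}
    (i₁ : V₁ ≤ ι ⁻¹ᵁ U₀) (k₁ : W' ≤ b ⁻¹ᵁ V₁) (j : W' ⟶ b ⁻¹ᵁ (ι ⁻¹ᵁ U₀)) (m : Γ(F, U₀)) :
    unitSectionLE b ((Scheme.Modules.pullback ι).obj F) k₁ (unitSectionLE ι F i₁ m) =
      ((Scheme.Modules.pullback b).obj ((Scheme.Modules.pullback ι).obj F)).presheaf.map j.op
        (unitSection b ((Scheme.Modules.pullback ι).obj F) (ι ⁻¹ᵁ U₀) (unitSection ι F U₀ m)) := by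
  rw [unitSectionLE, unitSectionLE, unitSection_map, ← CategoryTheory.comp_apply, ← Functor.map_comp, ← op_comp]
  exact presheaf_map_congr _ _ _ _

/-- **★ `squareIso_hom_app_unitSection`, RESTRICTED**: the canonical `b^*ι^*F ≅ ι'^*a^*F` of a commuting square `b ≫ ι = ι' ≫ a`
sends `η_b(η_ι(m)|_{V₁})|_{W'}` to `η_{ι'}(η_a(m)|_{V₂})|_{W'}`. [cite: Hartshorne1977, II.5 (p. 110)] [cite: StacksProject, Tag 023N] -/
theorem squareIso_hom_app_unitSectionLE (hbι : b ≫ ι = ι' ≫ a) (F : X₀.Modules) {U₀ : X₀.Opens} {V₁ : S₀.Opens}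
    {V₂ : X'.Opens} {W' : S'.Opens} (i₁ : V₁ ≤ ι ⁻¹ᵁ U₀) (i₂ : V₂ ≤ a ⁻¹ᵁ U₀) (k₁ : W' ≤ b ⁻¹ᵁ V₁)
    (k₂ : W' ≤ ι' ⁻¹ᵁ V₂) (m : Γ(F, U₀)) :
    (squareIso hbι F).hom.app W' (unitSectionLE b ((Scheme.Modules.pullback ι).obj F) k₁ (unitSectionLE ι F i₁ m)) =
      unitSectionLE ι' ((Scheme.Modules.pullback a).obj F) k₂ (unitSectionLE a F i₂ m) := by
  have j₁ : W' ≤ b ⁻¹ᵁ (ι ⁻¹ᵁ U₀) := k₁.trans (b.preimage_mono i₁)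
  have j₂ : W' ≤ ι' ⁻¹ᵁ (a ⁻¹ᵁ U₀) := k₂.trans (ι'.preimage_mono i₂)
  rw [unitSectionLE_unitSectionLE_eq_map F i₁ k₁ (homOfLE j₁) m, unitSectionLE_unitSectionLE_eq_map F i₂ k₂ (homOfLE j₂) m,
    app_presheaf_map, squareIso_hom_app_unitSection, ← CategoryTheory.comp_apply, ← Functor.map_comp, ← op_comp]
  exact presheaf_map_congr _ _ _ _

end Plumbing

variable {S : Scheme.{u}} {P₃ P O Q : Over S} (e₁₂ e₁₃ e₂₃ : P₃ ⟶ P) (act pr₂ : P ⟶ O) (q : O ⟶ Q)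
  (E : O.left.Modules)
  (Φ : (Scheme.Modules.pullback act.left).obj E ⟶ (Scheme.Modules.pullback pr₂.left).obj E)
  {V : Q.left.Opens} {U : O.left.Opens} {W : P.left.Opens} {W₃ : P₃.left.Opens}

/-! ## §1 The triple chart: the pasted square, the canonical open `W₃ = e₁₂⁻¹W ⊓ e₂₃⁻¹W`, affineness -/

/-- The PASTED square `P₃ ≅ P ×_Q O`: `IsPullback (e₂₃ ≫ pr₂) e₁₂ q (pr₂ ≫ q)` from the triple square
`hsq₃ : IsPullback e₁₂ e₂₃ pr₂ act` pasted next to the (flipped) torsor square. [cite: SGA1, Exp. VIII §1, Thm. 1.1] [cite: StacksProject, Tag 023N] -/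
theorem isPullback_triple_paste (hsq : IsPullback act.left pr₂.left q.left q.left)
    (hsq₃ : IsPullback e₁₂.left e₂₃.left pr₂.left act.left) :
    IsPullback (e₂₃.left ≫ pr₂.left) e₁₂.left q.left (pr₂.left ≫ q.left) :=
  hsq₃.flip.paste_horiz hsq.flip

/-- `W₃ = e₁₂⁻¹W ⊓ e₂₃⁻¹W ≤ e₁₃⁻¹W` for the canonical `W = act⁻¹U ⊓ pr₂⁻¹U` (faces over vertex 1 and vertex 3). [cite: StacksProject, Tag 023N] -/
theorem preimage_inf_preimage_le (h₁ : e₁₃.left ≫ act.left = e₁₂.left ≫ act.left)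
    (h₃ : e₂₃.left ≫ pr₂.left = e₁₃.left ≫ pr₂.left) :
    e₁₂.left ⁻¹ᵁ (act.left ⁻¹ᵁ U ⊓ pr₂.left ⁻¹ᵁ U) ⊓ e₂₃.left ⁻¹ᵁ (act.left ⁻¹ᵁ U ⊓ pr₂.left ⁻¹ᵁ U) ≤
      e₁₃.left ⁻¹ᵁ (act.left ⁻¹ᵁ U ⊓ pr₂.left ⁻¹ᵁ U) := by
  have ha : e₁₃.left ⁻¹ᵁ (act.left ⁻¹ᵁ U) = e₁₂.left ⁻¹ᵁ (act.left ⁻¹ᵁ U) := by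
    rw [← Scheme.Hom.comp_preimage, ← Scheme.Hom.comp_preimage, h₁]
  have hp : e₁₃.left ⁻¹ᵁ (pr₂.left ⁻¹ᵁ U) = e₂₃.left ⁻¹ᵁ (pr₂.left ⁻¹ᵁ U) := by
    rw [← Scheme.Hom.comp_preimage, ← Scheme.Hom.comp_preimage, h₃]
  rw [Scheme.Hom.preimage_inf, Scheme.Hom.preimage_inf, Scheme.Hom.preimage_inf, ha, hp]
  exact le_inf (inf_le_left.trans inf_le_left) (inf_le_right.trans inf_le_right)

/-- `W₃ = e₁₂⁻¹W ⊓ e₂₃⁻¹W = (e₂₃ ≫ pr₂)⁻¹U ⊓ e₁₂⁻¹W` (the shape of the pasted square's chart). [cite: StacksProject, Tag 023N] -/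
theorem preimage_inf_preimage_eq (h₂ : e₁₂.left ≫ pr₂.left = e₂₃.left ≫ act.left) :
    e₁₂.left ⁻¹ᵁ (act.left ⁻¹ᵁ U ⊓ pr₂.left ⁻¹ᵁ U) ⊓ e₂₃.left ⁻¹ᵁ (act.left ⁻¹ᵁ U ⊓ pr₂.left ⁻¹ᵁ U) =
      (e₂₃.left ≫ pr₂.left) ⁻¹ᵁ U ⊓ e₁₂.left ⁻¹ᵁ (act.left ⁻¹ᵁ U ⊓ pr₂.left ⁻¹ᵁ U) := by
  have ha : e₂₃.left ⁻¹ᵁ (act.left ⁻¹ᵁ U) = e₁₂.left ⁻¹ᵁ (pr₂.left ⁻¹ᵁ U) := by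
    rw [← Scheme.Hom.comp_preimage, ← Scheme.Hom.comp_preimage, h₂]
  rw [Scheme.Hom.preimage_inf, Scheme.Hom.preimage_inf, Scheme.Hom.comp_preimage, ha]
  apply le_antisymm
  · exact le_inf (inf_le_right.trans inf_le_right) inf_le_left
  · exact le_inf inf_le_right (le_inf (inf_le_right.trans inf_le_right) inf_le_left)

/-- The triple chart `W₃ = e₁₂⁻¹W ⊓ e₂₃⁻¹W` is affine when `U` and `W` are (★ `isAffineOpen_of_isPullback_of_eq_inf`). [cite: GortzWedhorn2020, Prop. 4.16 (pp. 101–104)] -/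
theorem isAffineOpen_triple (hsq₃ : IsPullback e₁₂.left e₂₃.left pr₂.left act.left) (hU : IsAffineOpen U)
    (hW : IsAffineOpen (act.left ⁻¹ᵁ U ⊓ pr₂.left ⁻¹ᵁ U)) :
    IsAffineOpen (e₁₂.left ⁻¹ᵁ (act.left ⁻¹ᵁ U ⊓ pr₂.left ⁻¹ᵁ U) ⊓ e₂₃.left ⁻¹ᵁ (act.left ⁻¹ᵁ U ⊓ pr₂.left ⁻¹ᵁ U)) :=
  isAffineOpen_of_isPullback_of_eq_inf hsq₃ hU hW hW inf_le_left inf_le_right rfl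

/-! ## §2 The three cofaces `π₁₂ π₁₃ π₂₃ = e♯ : Γ(W) → Γ(W₃)` and the face identities over the vertices -/

/-- `e♯ (f♯ s) = (e ≫ f)♯ s` on sections (`appLE` composition, pointwise). [cite: GortzWedhorn2020, Prop. 4.16 (pp. 101–104)] -/
theorem appLE_appLE {X Y Z : Scheme.{u}} (e : X ⟶ Y) (f : Y ⟶ Z) {U' : Z.Opens} {W' : Y.Opens} {W'' : X.Opens}
    (i : W' ≤ f ⁻¹ᵁ U') (k : W'' ≤ e ⁻¹ᵁ W') (s : Γ(Z, U')) :
    e.appLE W' W'' k (f.appLE U' W' i s) = (e ≫ f).appLE U' W'' (k.trans (e.preimage_mono i)) s := by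
  change (f.appLE U' W' i ≫ e.appLE W' W'' k) s = _
  rw [Scheme.Hom.appLE_comp_appLE]

/-- FACE over vertex 1 (`hF₁`): `π₁₃ ∘ act♯ = π₁₂ ∘ act♯` on `Γ(U)`. [cite: StacksProject, Tag 023N] [cite: MumfordFogartyKirwan1994, Ch. 1 §3 Def. 1.6 (p. 30)] -/
theorem appLE₁₃_appLE_act (h₁ : e₁₃.left ≫ act.left = e₁₂.left ≫ act.left) (hWa : W ≤ act.left ⁻¹ᵁ U)
    (k₁₂ : W₃ ≤ e₁₂.left ⁻¹ᵁ W) (k₁₃ : W₃ ≤ e₁₃.left ⁻¹ᵁ W) (s : Γ(O.left, U)) :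
    e₁₃.left.appLE W W₃ k₁₃ (act.left.appLE U W hWa s) = e₁₂.left.appLE W W₃ k₁₂ (act.left.appLE U W hWa s) := by
  have appLE_congr_apply : ∀ {X' Y' : Scheme.{u}} {f₁ f₂ : X' ⟶ Y'} (_ : f₁ = f₂) (U' : Y'.Opens) (W' : X'.Opens)
      (k₁ : W' ≤ f₁ ⁻¹ᵁ U') (k₂ : W' ≤ f₂ ⁻¹ᵁ U') (s : Γ(Y', U')), f₁.appLE U' W' k₁ s = f₂.appLE U' W' k₂ s := by
    rintro _ _ _ _ rfl _ _ _ _ _; rfl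
  rw [appLE_appLE, appLE_appLE, appLE_congr_apply h₁]

/-- FACE over vertex 2 (`hF₂`): `π₂₃ ∘ act♯ = π₁₂ ∘ pr₂♯` on `Γ(U)`. [cite: StacksProject, Tag 023N] [cite: MumfordFogartyKirwan1994, Ch. 1 §3 Def. 1.6 (p. 30)] -/
theorem appLE₂₃_appLE_act (h₂ : e₁₂.left ≫ pr₂.left = e₂₃.left ≫ act.left) (hWa : W ≤ act.left ⁻¹ᵁ U)
    (hWp : W ≤ pr₂.left ⁻¹ᵁ U) (k₁₂ : W₃ ≤ e₁₂.left ⁻¹ᵁ W) (k₂₃ : W₃ ≤ e₂₃.left ⁻¹ᵁ W) (s : Γ(O.left, U)) :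
    e₂₃.left.appLE W W₃ k₂₃ (act.left.appLE U W hWa s) = e₁₂.left.appLE W W₃ k₁₂ (pr₂.left.appLE U W hWp s) := by
  have appLE_congr_apply : ∀ {X' Y' : Scheme.{u}} {f₁ f₂ : X' ⟶ Y'} (_ : f₁ = f₂) (U' : Y'.Opens) (W' : X'.Opens)
      (k₁ : W' ≤ f₁ ⁻¹ᵁ U') (k₂ : W' ≤ f₂ ⁻¹ᵁ U') (s : Γ(Y', U')), f₁.appLE U' W' k₁ s = f₂.appLE U' W' k₂ s := by
    rintro _ _ _ _ rfl _ _ _ _ _; rfl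
  rw [appLE_appLE, appLE_appLE, appLE_congr_apply h₂.symm]

/-- FACE over vertex 3 (`hF₃`): `π₁₃ ∘ pr₂♯ = π₂₃ ∘ pr₂♯` on `Γ(U)`. [cite: StacksProject, Tag 023N] [cite: MumfordFogartyKirwan1994, Ch. 1 §3 Def. 1.6 (p. 30)] -/
theorem appLE₁₃_appLE_snd (h₃ : e₂₃.left ≫ pr₂.left = e₁₃.left ≫ pr₂.left) (hWp : W ≤ pr₂.left ⁻¹ᵁ U)
    (k₁₃ : W₃ ≤ e₁₃.left ⁻¹ᵁ W) (k₂₃ : W₃ ≤ e₂₃.left ⁻¹ᵁ W) (s : Γ(O.left, U)) :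
    e₁₃.left.appLE W W₃ k₁₃ (pr₂.left.appLE U W hWp s) = e₂₃.left.appLE W W₃ k₂₃ (pr₂.left.appLE U W hWp s) := by
  have appLE_congr_apply : ∀ {X' Y' : Scheme.{u}} {f₁ f₂ : X' ⟶ Y'} (_ : f₁ = f₂) (U' : Y'.Opens) (W' : X'.Opens)
      (k₁ : W' ≤ f₁ ⁻¹ᵁ U') (k₂ : W' ≤ f₂ ⁻¹ᵁ U') (s : Γ(Y', U')), f₁.appLE U' W' k₁ s = f₂.appLE U' W' k₂ s := by
    rintro _ _ _ _ rfl _ _ _ _ _; rfl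
  rw [appLE_appLE, appLE_appLE, appLE_congr_apply h₃.symm]

/-! ## §3 The transitions `t₂ := η_{e₁₂}(–)|_{W₃}`, `t₃ := η_{e₁₃}(–)|_{W₃}`, `t₃' := can (η_{e₂₃}(–)|_{W₃})` of sections of `pr₂^*E`
and the transfer `Φ₂₃ := can ≫ e₂₃^*Φ ≫ can`: semilinearity -/

/-- `t₂` is `π₁₂`-semilinear (`ht₂`). [cite: GortzWedhorn2020, Prop. 14.66] -/
theorem transition₁₂_smul (k₁₂ : W₃ ≤ e₁₂.left ⁻¹ᵁ W) (c : Γ(P.left, W))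
    (y : Γ((Scheme.Modules.pullback pr₂.left).obj E, W)) :
    unitSectionLE e₁₂.left ((Scheme.Modules.pullback pr₂.left).obj E) k₁₂ (c • y) =
      e₁₂.left.appLE W W₃ k₁₂ c • unitSectionLE e₁₂.left ((Scheme.Modules.pullback pr₂.left).obj E) k₁₂ y :=
  unitSectionLE_smul _ _ _ c y

/-- `t₃` is `π₁₃`-semilinear (`ht₃`). [cite: GortzWedhorn2020, Prop. 14.66] -/
theorem transition₁₃_smul (k₁₃ : W₃ ≤ e₁₃.left ⁻¹ᵁ W) (c : Γ(P.left, W))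
    (y : Γ((Scheme.Modules.pullback pr₂.left).obj E, W)) :
    unitSectionLE e₁₃.left ((Scheme.Modules.pullback pr₂.left).obj E) k₁₃ (c • y) =
      e₁₃.left.appLE W W₃ k₁₃ c • unitSectionLE e₁₃.left ((Scheme.Modules.pullback pr₂.left).obj E) k₁₃ y :=
  unitSectionLE_smul _ _ _ c y

/-- `t₃'` is `π₂₃`-semilinear (`ht₃'`). [cite: GortzWedhorn2020, Prop. 14.66] -/
theorem cotransition₂₃_smul (h₃ : e₂₃.left ≫ pr₂.left = e₁₃.left ≫ pr₂.left) (k₂₃ : W₃ ≤ e₂₃.left ⁻¹ᵁ W)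
    (c : Γ(P.left, W)) (y : Γ((Scheme.Modules.pullback pr₂.left).obj E, W)) :
    (squareIso h₃ E).hom.app W₃ (unitSectionLE e₂₃.left ((Scheme.Modules.pullback pr₂.left).obj E) k₂₃ (c • y)) =
      e₂₃.left.appLE W W₃ k₂₃ c •
        (squareIso h₃ E).hom.app W₃ (unitSectionLE e₂₃.left ((Scheme.Modules.pullback pr₂.left).obj E) k₂₃ y) := by
  rw [unitSectionLE_smul, Scheme.Modules.Hom.app_smul]

/-- `Φ₂₃` is `Γ(W₃)`-linear. [cite: GortzWedhorn2020, Prop. 14.66] -/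
theorem transfer₂₃_smul (h₂ : e₁₂.left ≫ pr₂.left = e₂₃.left ≫ act.left)
    (h₃ : e₂₃.left ≫ pr₂.left = e₁₃.left ≫ pr₂.left) (d : Γ(P₃.left, W₃))
    (z : Γ((Scheme.Modules.pullback e₁₂.left).obj ((Scheme.Modules.pullback pr₂.left).obj E), W₃)) :
    (squareIso h₃ E).hom.app W₃ (((Scheme.Modules.pullback e₂₃.left).map Φ).app W₃ ((squareIso h₂ E).hom.app W₃ (d • z))) =
      d • (squareIso h₃ E).hom.app W₃ (((Scheme.Modules.pullback e₂₃.left).map Φ).app W₃ ((squareIso h₂ E).hom.app W₃ z)) := by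
  rw [Scheme.Modules.Hom.app_smul, Scheme.Modules.Hom.app_smul, Scheme.Modules.Hom.app_smul]

/-! ## §4 The identities on unit sections (`hk₃`, `hΦ₂₃`), the level-3 base change (`hb₃`) and the triple ring isomorphism (`hlift₃`) -/

/-- **`hk₃`**: `t₃ (η_pr₂(x)|_W) = t₃' (η_pr₂(x)|_W)` — both are `η_{e₁₃}(η_pr₂(x))|_{W₃}`. [cite: StacksProject, Tag 023N] [cite: GortzWedhorn2020, Thm. 14.68] -/
theorem transition₁₃_unitSectionLE (h₃ : e₂₃.left ≫ pr₂.left = e₁₃.left ≫ pr₂.left) (hWp : W ≤ pr₂.left ⁻¹ᵁ U)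
    (k₁₃ : W₃ ≤ e₁₃.left ⁻¹ᵁ W) (k₂₃ : W₃ ≤ e₂₃.left ⁻¹ᵁ W) (x : Γ(E, U)) :
    unitSectionLE e₁₃.left ((Scheme.Modules.pullback pr₂.left).obj E) k₁₃ (unitSectionLE pr₂.left E hWp x) =
      (squareIso h₃ E).hom.app W₃
        (unitSectionLE e₂₃.left ((Scheme.Modules.pullback pr₂.left).obj E) k₂₃ (unitSectionLE pr₂.left E hWp x)) :=
  (squareIso_hom_app_unitSectionLE h₃ E hWp hWp k₂₃ k₁₃ x).symm

/-- **`hΦ₂₃`**: `Φ₂₃ (t₂ (η_pr₂(x)|_W)) = t₃' (Φ_W (η_act(x)|_W))` (the square `h₂` on unit sections, then naturality of `η_{e₂₃}` in `Φ`). [cite: StacksProject, Tag 023N] [cite: GortzWedhorn2020, Thm. 14.68] -/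
theorem transfer₂₃_transition₁₂_unitSectionLE (h₂ : e₁₂.left ≫ pr₂.left = e₂₃.left ≫ act.left)
    (h₃ : e₂₃.left ≫ pr₂.left = e₁₃.left ≫ pr₂.left) (hWa : W ≤ act.left ⁻¹ᵁ U) (hWp : W ≤ pr₂.left ⁻¹ᵁ U)
    (k₁₂ : W₃ ≤ e₁₂.left ⁻¹ᵁ W) (k₂₃ : W₃ ≤ e₂₃.left ⁻¹ᵁ W) (x : Γ(E, U)) :
    (squareIso h₃ E).hom.app W₃ (((Scheme.Modules.pullback e₂₃.left).map Φ).app W₃ ((squareIso h₂ E).hom.app W₃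
        (unitSectionLE e₁₂.left ((Scheme.Modules.pullback pr₂.left).obj E) k₁₂ (unitSectionLE pr₂.left E hWp x)))) =
      (squareIso h₃ E).hom.app W₃
        (unitSectionLE e₂₃.left ((Scheme.Modules.pullback pr₂.left).obj E) k₂₃ (Φ.app W (unitSectionLE act.left E hWa x))) := by
  rw [squareIso_hom_app_unitSectionLE h₂ E hWp hWa k₁₂ k₂₃ x, pullback_map_app_unitSectionLE]

/-- **`hb₃`**: `Γ(W₃, e₁₃^* pr₂^* E)` is the base change of `Γ(W, pr₂^*E)` along `π₁₃ = e₁₃♯` (★ `isBaseChange_unitSectionLE`, `pr₂^*E` quasi-coherent). [cite: GortzWedhorn2020, Prop. 14.66] [cite: StacksProject, Tag 023N] -/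
theorem isBaseChange_transition₁₃ [E.IsQuasicoherent] (k₁₃ : W₃ ≤ e₁₃.left ⁻¹ᵁ W) (hW : IsAffineOpen W)
    (hW₃ : IsAffineOpen W₃) :
    letI := (e₁₃.left.appLE W W₃ k₁₃).hom.toAlgebra
    letI : Module Γ(P.left, W) Γ((Scheme.Modules.pullback e₁₃.left).obj ((Scheme.Modules.pullback pr₂.left).obj E), W₃) :=
      Module.compHom _ (e₁₃.left.appLE W W₃ k₁₃).hom
    haveI : IsScalarTower Γ(P.left, W) Γ(P₃.left, W₃)
        Γ((Scheme.Modules.pullback e₁₃.left).obj ((Scheme.Modules.pullback pr₂.left).obj E), W₃) :=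
      ⟨fun a b x => mul_smul ((e₁₃.left.appLE W W₃ k₁₃).hom a) b x⟩
    IsBaseChange Γ(P₃.left, W₃) (unitSectionLEₗ e₁₃.left ((Scheme.Modules.pullback pr₂.left).obj E) k₁₃) :=
  isBaseChange_unitSectionLE e₁₃.left _ k₁₃ hW hW₃ ((IsAffineLocalizing.of_isQuasicoherent E).pullback pr₂.left)

/-- **The TRIPLE RING ISOMORPHISM (`hlift₃`)**: `Γ(U) ⊗_{Γ(V)} Γ(W) ≅ Γ(W₃)` with `a ⊗ 1 ↦ (e₂₃ ≫ pr₂)♯ a` and `1 ⊗ c ↦ e₁₂♯ c`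
(Mathlib `isIso_pushoutSection_of_isAffineOpen` at the pasted square `IsPullback (e₂₃ ≫ pr₂) e₁₂ q (pr₂ ≫ q)`); with PART 1's
`Γ(W) ≅ Γ(U) ⊗_{Γ(V)} Γ(U)` this is `Γ(W₃) ≅ Γ(U)^{⊗ 3}` through the three vertex maps. [cite: GortzWedhorn2020, Prop. 4.16 (pp. 101–104)] [cite: StacksProject, Tag 023M] -/
theorem exists_ringEquiv_tensorProduct_triple (hsq : IsPullback act.left pr₂.left q.left q.left)
    (hsq₃ : IsPullback e₁₂.left e₂₃.left pr₂.left act.left) (hV : IsAffineOpen V) (hU : IsAffineOpen U)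
    (hW : IsAffineOpen W) (hUV : U ≤ q.left ⁻¹ᵁ V) (hWp : W ≤ pr₂.left ⁻¹ᵁ U)
    (hW₃ : W₃ = (e₂₃.left ≫ pr₂.left) ⁻¹ᵁ U ⊓ e₁₂.left ⁻¹ᵁ W) :
    letI := (q.left.appLE V U hUV).hom.toAlgebra
    letI := ((pr₂.left ≫ q.left).appLE V W (hWp.trans (pr₂.left.preimage_mono hUV))).hom.toAlgebra
    ∃ e : Γ(O.left, U) ⊗[Γ(Q.left, V)] Γ(P.left, W) ≃+* Γ(P₃.left, W₃),
      (∀ a, e (a ⊗ₜ 1) = (e₂₃.left ≫ pr₂.left).appLE U W₃ (hW₃.trans_le inf_le_left) a) ∧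
      (∀ c, e (1 ⊗ₜ c) = e₁₂.left.appLE W W₃ (hW₃.trans_le inf_le_right) c) := by
  letI := (q.left.appLE V U hUV).hom.toAlgebra
  letI := ((pr₂.left ≫ q.left).appLE V W (hWp.trans (pr₂.left.preimage_mono hUV))).hom.toAlgebra
  have H₂ := isPullback_triple_paste e₁₂ e₂₃ act pr₂ q hsq hsq₃
  have H := (isIso_pushoutSection_iff H₂ (hWp.trans (pr₂.left.preimage_mono hUV)) hUV hW₃).mp
    (isIso_pushoutSection_of_isAffineOpen H₂ _ hUV hW₃ hV hW hU)
  let e := ((CommRingCat.isPushout_tensorProduct Γ(Q.left, V) Γ(O.left, U) Γ(P.left, W)).isoIsPushout _ _ H)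
  refine ⟨e.commRingCatIsoToRingEquiv, fun a => ?_, fun c => ?_⟩
  · have h := (CommRingCat.isPushout_tensorProduct Γ(Q.left, V) Γ(O.left, U) Γ(P.left, W)).inl_isoIsPushout_hom _ _ H
    exact congr($(h).hom a)
  · have h := (CommRingCat.isPushout_tensorProduct Γ(Q.left, V) Γ(O.left, U) Γ(P.left, W)).inr_isoIsPushout_hom _ _ H
    exact congr($(h).hom c)

/-- **Pure algebra for `hlift₃`**: if `lift ψ₁ ψ₂ : A ⊗_R A → B` is bijective and `e₃ : A ⊗_R B ≃+* C` has `e₃ (c ⊗ 1) = π₁₃ (ψ₂ c)` and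
`e₃ (1 ⊗ w) = π₁₂ w`, then the three-vertex map `lift (lift (π₁₂ ∘ ψ₁) (π₁₂ ∘ ψ₂)) (π₁₃ ∘ ψ₂) : (A ⊗_R A) ⊗_R A → C` is bijective — it is
`e₃ ∘ comm ∘ (lift ψ₁ ψ₂ ⊗ 𝟙)`. (The ring-level triple isomorphism `Γ(W₃) ≅ Γ(U)^{⊗3}` from `Γ(W) ≅ Γ(U) ⊗ Γ(U)` and `Γ(W₃) ≅ Γ(U) ⊗ Γ(W)`.)
[cite: StacksProject, Tag 023M] [cite: GortzWedhorn2020, Prop. 4.16 (pp. 101–104)] -/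
theorem bijective_lift_lift_of_ringEquiv {R : Type u} {A B C : Type u} [CommRing R] [CommRing A] [CommRing B] [CommRing C]
    [Algebra R A] [Algebra R B] [Algebra R C] (ψ₁ ψ₂ : A →ₐ[R] B) (π₁₂ π₁₃ : B →ₐ[R] C)
    (hψ : Function.Bijective (Algebra.TensorProduct.lift ψ₁ ψ₂ (fun _ _ => Commute.all _ _)))
    (e₃ : A ⊗[R] B ≃+* C) (he₃a : ∀ c : A, e₃ (c ⊗ₜ 1) = π₁₃ (ψ₂ c)) (he₃c : ∀ w : B, e₃ (1 ⊗ₜ w) = π₁₂ w) :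
    Function.Bijective (Algebra.TensorProduct.lift
      (Algebra.TensorProduct.lift (π₁₂.comp ψ₁) (π₁₂.comp ψ₂) (fun _ _ => Commute.all _ _)) (π₁₃.comp ψ₂)
      (fun _ _ => Commute.all _ _)) := by
  let F : (A ⊗[R] A) ⊗[R] A →ₗ[R] A ⊗[R] B :=
    (TensorProduct.comm R B A).toLinearMap ∘ₗ
      (LinearEquiv.rTensor A (LinearEquiv.ofBijective (Algebra.TensorProduct.lift ψ₁ ψ₂ (fun _ _ => Commute.all _ _)).toLinearMap hψ)).toLinearMap
  have hF : Function.Bijective F :=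
    (TensorProduct.comm R B A).bijective.comp
      (LinearEquiv.rTensor A (LinearEquiv.ofBijective (Algebra.TensorProduct.lift ψ₁ ψ₂ (fun _ _ => Commute.all _ _)).toLinearMap hψ)).bijective
  have hF_tmul : ∀ a b c : A, F ((a ⊗ₜ b) ⊗ₜ c) = c ⊗ₜ (ψ₁ a * ψ₂ b) := by
    intro a b c
    simp only [F, LinearMap.coe_comp, Function.comp_apply, LinearEquiv.coe_toLinearMap, LinearEquiv.rTensor_tmul,
      LinearEquiv.ofBijective_apply, AlgHom.toLinearMap_apply, Algebra.TensorProduct.lift_tmul, TensorProduct.comm_tmul]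
  have he₃_tmul : ∀ (c : A) (w : B), e₃ (c ⊗ₜ w) = π₁₃ (ψ₂ c) * π₁₂ w := by
    intro c w
    have hcw : c ⊗ₜ[R] w = (c ⊗ₜ[R] 1) * (1 ⊗ₜ[R] w) := by rw [Algebra.TensorProduct.tmul_mul_tmul, mul_one, one_mul]
    rw [hcw, map_mul, he₃a, he₃c]
  have key : ∀ z, Algebra.TensorProduct.lift (Algebra.TensorProduct.lift (π₁₂.comp ψ₁) (π₁₂.comp ψ₂) (fun _ _ => Commute.all _ _))
      (π₁₃.comp ψ₂) (fun _ _ => Commute.all _ _) z = e₃ (F z) := by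
    intro z
    induction z using TensorProduct.induction_on with
    | zero => simp
    | tmul w c =>
        induction w using TensorProduct.induction_on with
        | zero => simp
        | tmul a b =>
            rw [hF_tmul, he₃_tmul, Algebra.TensorProduct.lift_tmul, Algebra.TensorProduct.lift_tmul, AlgHom.comp_apply,
              AlgHom.comp_apply, AlgHom.comp_apply, map_mul]
            ring
        | add x y hx hy => rw [TensorProduct.add_tmul, map_add, map_add, map_add, hx, hy]
    | add x y hx hy => rw [map_add, map_add, map_add, hx, hy]
  rw [show ⇑(Algebra.TensorProduct.lift (Algebra.TensorProduct.lift (π₁₂.comp ψ₁) (π₁₂.comp ψ₂) (fun _ _ => Commute.all _ _))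
      (π₁₃.comp ψ₂) (fun _ _ => Commute.all _ _)) = ⇑e₃ ∘ ⇑F from funext key]
  exact e₃.bijective.comp hF

/-! ## §5 THE COCYCLE ON UNIT SECTIONS (`hcocycle`) from the scheme-level cocycle `hcoc` (`Linearisation.iso_mul_hom` shape) -/

/-- **`hcocycle`**: `t₃ (Φ_W (η_act(x)|_W)) = Φ₂₃ (t₂ (Φ_W (η_act(x)|_W)))` — the cocycle `(e₁₃)^*Φ = can ≫ (e₁₂)^*Φ ≫ can ≫
(e₂₃)^*Φ ≫ can` evaluated at the unit section `η_{e₁₃}(η_act(x)|_W)|_{W₃}`. [cite: MumfordFogartyKirwan1994, Ch. 1 §3 Def. 1.6 (p. 30)] [cite: StacksProject, Tag 023N] [cite: GortzWedhorn2020, Thm. 14.68] -/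
theorem transition₁₃_coface_eq_of_cocycle (h₁ : e₁₃.left ≫ act.left = e₁₂.left ≫ act.left)
    (h₂ : e₁₂.left ≫ pr₂.left = e₂₃.left ≫ act.left) (h₃ : e₂₃.left ≫ pr₂.left = e₁₃.left ≫ pr₂.left)
    (hcoc : (Scheme.Modules.pullback e₁₃.left).map Φ =
      (squareIso h₁ E).hom ≫ (Scheme.Modules.pullback e₁₂.left).map Φ ≫ (squareIso h₂ E).hom ≫
        (Scheme.Modules.pullback e₂₃.left).map Φ ≫ (squareIso h₃ E).hom)
    (hWa : W ≤ act.left ⁻¹ᵁ U) (k₁₂ : W₃ ≤ e₁₂.left ⁻¹ᵁ W) (k₁₃ : W₃ ≤ e₁₃.left ⁻¹ᵁ W) (x : Γ(E, U)) :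
    unitSectionLE e₁₃.left ((Scheme.Modules.pullback pr₂.left).obj E) k₁₃ (Φ.app W (unitSectionLE act.left E hWa x)) =
      (squareIso h₃ E).hom.app W₃ (((Scheme.Modules.pullback e₂₃.left).map Φ).app W₃ ((squareIso h₂ E).hom.app W₃
        (unitSectionLE e₁₂.left ((Scheme.Modules.pullback pr₂.left).obj E) k₁₂ (Φ.app W (unitSectionLE act.left E hWa x))))) := by
  have h := congrArg (fun ψ => (Scheme.Modules.Hom.app ψ W₃)
    (unitSectionLE e₁₃.left ((Scheme.Modules.pullback act.left).obj E) k₁₃ (unitSectionLE act.left E hWa x))) hcoc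
  simp only [Scheme.Modules.Hom.comp_app, CategoryTheory.comp_apply] at h
  rw [pullback_map_app_unitSectionLE, squareIso_hom_app_unitSectionLE h₁ E hWa hWa k₁₃ k₁₂ x,
    pullback_map_app_unitSectionLE] at h
  exact h

/-! ## §6 THE JOINT HEAD — effective descent on one affine chart of a torsor quotient, from the scheme-level unit and cocycle -/

set_option maxHeartbeats 400000 in -- §6: nine structure literals + 23 hypotheses of the ring head in one assembly (2× default)
/-- **The chart theorem with the triple chart as a binder** (`hW₃ : W₃ = e₁₂⁻¹W ⊓ e₂₃⁻¹W`; the head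
`isBaseChange_of_range_eq_equaliser` below is this at `hW₃ := rfl`).  Keeping `W₃` a variable is what keeps the one assembly of the ring
head's 23 hypotheses inside the house heartbeat budget. [cite: SGA1, Exp. VIII §1, Thm. 1.1] [cite: StacksProject, Tag 023N] [cite: GortzWedhorn2020, Thm. 14.68] [cite: MumfordAV1970, §12 Thm. 1 (B) (p. 112)] -/
theorem isBaseChange_of_range_eq_equaliser_of_eq [Flat q.left] [Surjective q.left] [E.IsQuasicoherent]
    (hsq : IsPullback act.left pr₂.left q.left q.left) (hsq₃ : IsPullback e₁₂.left e₂₃.left pr₂.left act.left)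
    (h₁ : e₁₃.left ≫ act.left = e₁₂.left ≫ act.left) (h₂ : e₁₂.left ≫ pr₂.left = e₂₃.left ≫ act.left)
    (h₃ : e₂₃.left ≫ pr₂.left = e₁₃.left ≫ pr₂.left)
    (hcoc : (Scheme.Modules.pullback e₁₃.left).map Φ =
      (squareIso h₁ E).hom ≫ (Scheme.Modules.pullback e₁₂.left).map Φ ≫ (squareIso h₂ E).hom ≫
        (Scheme.Modules.pullback e₂₃.left).map Φ ≫ (squareIso h₃ E).hom)
    (u : O ⟶ P) (hu₁ : u.left ≫ act.left = 𝟙 O.left) (hu₂ : u.left ≫ pr₂.left = 𝟙 O.left)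
    (hunit : (Scheme.Modules.pullback u.left).map Φ = (sectionPullbackIso hu₁ E).hom ≫ (sectionPullbackIso hu₂ E).inv)
    (hV : IsAffineOpen V) (hU : IsAffineOpen (q.left ⁻¹ᵁ V))
    (hW₃ : W₃ = e₁₂.left ⁻¹ᵁ (act.left ⁻¹ᵁ (q.left ⁻¹ᵁ V) ⊓ pr₂.left ⁻¹ᵁ (q.left ⁻¹ᵁ V)) ⊓
      e₂₃.left ⁻¹ᵁ (act.left ⁻¹ᵁ (q.left ⁻¹ᵁ V) ⊓ pr₂.left ⁻¹ᵁ (q.left ⁻¹ᵁ V)))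
    {N : Type u} [AddCommGroup N] [Module Γ(Q.left, V) N]
    (j : letI : Module Γ(Q.left, V) Γ(E, q.left ⁻¹ᵁ V) := Module.compHom _ (q.left.appLE V (q.left ⁻¹ᵁ V) le_rfl).hom
      N →ₗ[Γ(Q.left, V)] Γ(E, q.left ⁻¹ᵁ V))
    (hjinj : Function.Injective j)
    (hj : ∀ s : Γ(E, q.left ⁻¹ᵁ V), s ∈ Set.range j ↔
      ((Scheme.Modules.pullback pr₂.left).obj E).presheaf.map
          (homOfLE (inf_le_left : act.left ⁻¹ᵁ (q.left ⁻¹ᵁ V) ⊓ pr₂.left ⁻¹ᵁ (q.left ⁻¹ᵁ V) ≤ act.left ⁻¹ᵁ (q.left ⁻¹ᵁ V))).op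
          (Φ.app (act.left ⁻¹ᵁ (q.left ⁻¹ᵁ V)) (unitSection act.left E (q.left ⁻¹ᵁ V) s)) =
        ((Scheme.Modules.pullback pr₂.left).obj E).presheaf.map
          (homOfLE (inf_le_right : act.left ⁻¹ᵁ (q.left ⁻¹ᵁ V) ⊓ pr₂.left ⁻¹ᵁ (q.left ⁻¹ᵁ V) ≤ pr₂.left ⁻¹ᵁ (q.left ⁻¹ᵁ V))).op
          (unitSection pr₂.left E (q.left ⁻¹ᵁ V) s)) :
    letI := (q.left.appLE V (q.left ⁻¹ᵁ V) le_rfl).hom.toAlgebra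
    letI : Module Γ(Q.left, V) Γ(E, q.left ⁻¹ᵁ V) := Module.compHom _ (q.left.appLE V (q.left ⁻¹ᵁ V) le_rfl).hom
    haveI : IsScalarTower Γ(Q.left, V) Γ(O.left, q.left ⁻¹ᵁ V) Γ(E, q.left ⁻¹ᵁ V) :=
      ⟨fun a b x => mul_smul ((q.left.appLE V (q.left ⁻¹ᵁ V) le_rfl).hom a) b x⟩
    IsBaseChange Γ(O.left, q.left ⁻¹ᵁ V) j := by
  -- ### the opens and their inclusions
  have appLE_congr_apply : ∀ {X' Y' : Scheme.{u}} {f₁ f₂ : X' ⟶ Y'} (_ : f₁ = f₂) (U' : Y'.Opens) (W' : X'.Opens)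
      (k₁ : W' ≤ f₁ ⁻¹ᵁ U') (k₂ : W' ≤ f₂ ⁻¹ᵁ U') (s : Γ(Y', U')), f₁.appLE U' W' k₁ s = f₂.appLE U' W' k₂ s := by
    rintro _ _ _ _ rfl _ _ _ _ _; rfl
  have hwq : act.left ≫ q.left = pr₂.left ≫ q.left := hsq.w
  have kWa : act.left ⁻¹ᵁ (q.left ⁻¹ᵁ V) ⊓ pr₂.left ⁻¹ᵁ (q.left ⁻¹ᵁ V) ≤ act.left ⁻¹ᵁ (q.left ⁻¹ᵁ V) := inf_le_left
  have kWp : act.left ⁻¹ᵁ (q.left ⁻¹ᵁ V) ⊓ pr₂.left ⁻¹ᵁ (q.left ⁻¹ᵁ V) ≤ pr₂.left ⁻¹ᵁ (q.left ⁻¹ᵁ V) := inf_le_right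
  have kRW : act.left ⁻¹ᵁ (q.left ⁻¹ᵁ V) ⊓ pr₂.left ⁻¹ᵁ (q.left ⁻¹ᵁ V) ≤ (pr₂.left ≫ q.left) ⁻¹ᵁ V := inf_le_right
  have k₁₂ : W₃ ≤ e₁₂.left ⁻¹ᵁ (act.left ⁻¹ᵁ (q.left ⁻¹ᵁ V) ⊓ pr₂.left ⁻¹ᵁ (q.left ⁻¹ᵁ V)) := hW₃.le.trans inf_le_left
  have k₂₃ : W₃ ≤ e₂₃.left ⁻¹ᵁ (act.left ⁻¹ᵁ (q.left ⁻¹ᵁ V) ⊓ pr₂.left ⁻¹ᵁ (q.left ⁻¹ᵁ V)) := hW₃.le.trans inf_le_right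
  have k₁₃ : W₃ ≤ e₁₃.left ⁻¹ᵁ (act.left ⁻¹ᵁ (q.left ⁻¹ᵁ V) ⊓ pr₂.left ⁻¹ᵁ (q.left ⁻¹ᵁ V)) :=
    hW₃.le.trans (preimage_inf_preimage_le e₁₂ e₁₃ e₂₃ act pr₂ h₁ h₃)
  have kR₃ : W₃ ≤ (e₁₂.left ≫ pr₂.left ≫ q.left) ⁻¹ᵁ V := k₁₂.trans (e₁₂.left.preimage_mono kRW)
  have hWu : q.left ⁻¹ᵁ V ≤ u.left ⁻¹ᵁ (act.left ⁻¹ᵁ (q.left ⁻¹ᵁ V) ⊓ pr₂.left ⁻¹ᵁ (q.left ⁻¹ᵁ V)) :=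
    le_preimage_inf act pr₂ u hu₁ hu₂ _
  have hW₃eq : W₃ = (e₂₃.left ≫ pr₂.left) ⁻¹ᵁ (q.left ⁻¹ᵁ V) ⊓ e₁₂.left ⁻¹ᵁ (act.left ⁻¹ᵁ (q.left ⁻¹ᵁ V) ⊓ pr₂.left ⁻¹ᵁ (q.left ⁻¹ᵁ V)) :=
    hW₃.trans (preimage_inf_preimage_eq e₁₂ e₂₃ act pr₂ (U := q.left ⁻¹ᵁ V) h₂)
  -- face identities over `Q`
  have f₂₃ : e₂₃.left ≫ pr₂.left ≫ q.left = e₁₂.left ≫ pr₂.left ≫ q.left := by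
    rw [show e₂₃.left ≫ pr₂.left ≫ q.left = (e₂₃.left ≫ act.left) ≫ q.left by rw [Category.assoc, hwq], ← h₂, Category.assoc]
  have f₁₃ : e₁₃.left ≫ pr₂.left ≫ q.left = e₁₂.left ≫ pr₂.left ≫ q.left := by
    rw [← Category.assoc, ← h₃, Category.assoc, f₂₃]
  have fu : u.left ≫ pr₂.left ≫ q.left = q.left := by rw [← Category.assoc, hu₂, Category.id_comp]
  -- affineness
  have hW : IsAffineOpen (act.left ⁻¹ᵁ (q.left ⁻¹ᵁ V) ⊓ pr₂.left ⁻¹ᵁ (q.left ⁻¹ᵁ V)) :=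
    isAffineOpen_of_isPullback_of_eq_inf hsq hV hU hU le_rfl le_rfl rfl
  have hW₃a : IsAffineOpen W₃ := by
    rw [hW₃]
    exact isAffineOpen_triple e₁₂ e₂₃ act pr₂ hsq₃ hU hW
  -- ### the four rings as `Γ(V)`-algebras
  letI iRS := (q.left.appLE V (q.left ⁻¹ᵁ V) le_rfl).hom.toAlgebra
  letI iRS₂ : Algebra Γ(Q.left, V) Γ(P.left, act.left ⁻¹ᵁ (q.left ⁻¹ᵁ V) ⊓ pr₂.left ⁻¹ᵁ (q.left ⁻¹ᵁ V)) :=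
    ((pr₂.left ≫ q.left).appLE V _ kRW).hom.toAlgebra
  letI iRS₃ : Algebra Γ(Q.left, V) Γ(P₃.left, W₃) :=
    ((e₁₂.left ≫ pr₂.left ≫ q.left).appLE V _ kR₃).hom.toAlgebra
  -- ### the modules and their `Γ(V)`-structures
  letI : Module Γ(Q.left, V) Γ(E, q.left ⁻¹ᵁ V) := Module.compHom _ (q.left.appLE V (q.left ⁻¹ᵁ V) le_rfl).hom
  haveI : IsScalarTower Γ(Q.left, V) Γ(O.left, q.left ⁻¹ᵁ V) Γ(E, q.left ⁻¹ᵁ V) :=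
    ⟨fun a b x => mul_smul ((q.left.appLE V (q.left ⁻¹ᵁ V) le_rfl).hom a) b x⟩
  letI : Module Γ(Q.left, V) Γ((Scheme.Modules.pullback act.left).obj E, act.left ⁻¹ᵁ (q.left ⁻¹ᵁ V) ⊓ pr₂.left ⁻¹ᵁ (q.left ⁻¹ᵁ V)) :=
    Module.compHom _ ((pr₂.left ≫ q.left).appLE V _ kRW).hom
  haveI : IsScalarTower Γ(Q.left, V) Γ(P.left, act.left ⁻¹ᵁ (q.left ⁻¹ᵁ V) ⊓ pr₂.left ⁻¹ᵁ (q.left ⁻¹ᵁ V))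
      Γ((Scheme.Modules.pullback act.left).obj E, act.left ⁻¹ᵁ (q.left ⁻¹ᵁ V) ⊓ pr₂.left ⁻¹ᵁ (q.left ⁻¹ᵁ V)) :=
    ⟨fun a b x => mul_smul (((pr₂.left ≫ q.left).appLE V _ kRW).hom a) b x⟩
  letI : Module Γ(Q.left, V) Γ((Scheme.Modules.pullback pr₂.left).obj E, act.left ⁻¹ᵁ (q.left ⁻¹ᵁ V) ⊓ pr₂.left ⁻¹ᵁ (q.left ⁻¹ᵁ V)) :=
    Module.compHom _ ((pr₂.left ≫ q.left).appLE V _ kRW).hom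
  haveI : IsScalarTower Γ(Q.left, V) Γ(P.left, act.left ⁻¹ᵁ (q.left ⁻¹ᵁ V) ⊓ pr₂.left ⁻¹ᵁ (q.left ⁻¹ᵁ V))
      Γ((Scheme.Modules.pullback pr₂.left).obj E, act.left ⁻¹ᵁ (q.left ⁻¹ᵁ V) ⊓ pr₂.left ⁻¹ᵁ (q.left ⁻¹ᵁ V)) :=
    ⟨fun a b x => mul_smul (((pr₂.left ≫ q.left).appLE V _ kRW).hom a) b x⟩
  letI : Module Γ(Q.left, V) Γ((Scheme.Modules.pullback e₁₂.left).obj ((Scheme.Modules.pullback pr₂.left).obj E),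
      W₃) :=
    Module.compHom _ ((e₁₂.left ≫ pr₂.left ≫ q.left).appLE V _ kR₃).hom
  letI : Module Γ(Q.left, V) Γ((Scheme.Modules.pullback e₁₃.left).obj ((Scheme.Modules.pullback pr₂.left).obj E),
      W₃) :=
    Module.compHom _ ((e₁₂.left ≫ pr₂.left ≫ q.left).appLE V _ kR₃).hom
  haveI : IsScalarTower Γ(Q.left, V)
      Γ(P₃.left, W₃)
      Γ((Scheme.Modules.pullback e₁₃.left).obj ((Scheme.Modules.pullback pr₂.left).obj E),
        W₃) :=
    ⟨fun a b x => mul_smul (((e₁₂.left ≫ pr₂.left ≫ q.left).appLE V _ kR₃).hom a) b x⟩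
  haveI : Module.FaithfullyFlat Γ(Q.left, V) Γ(O.left, q.left ⁻¹ᵁ V) := faithfullyFlat_appLE_quotient q hV hU
  -- ### the structure-map identities (pointwise, term-mode)
  have hψ₁c : ∀ r : Γ(Q.left, V), act.left.appLE (q.left ⁻¹ᵁ V) _ kWa (q.left.appLE V (q.left ⁻¹ᵁ V) le_rfl r) =
      (pr₂.left ≫ q.left).appLE V _ kRW r := fun r =>
    (appLE_act_comp_appLE_eq act pr₂ q hwq r).trans (appLE_appLE pr₂.left q.left le_rfl kWp r)
  have hψ₂c : ∀ r : Γ(Q.left, V), pr₂.left.appLE (q.left ⁻¹ᵁ V) _ kWp (q.left.appLE V (q.left ⁻¹ᵁ V) le_rfl r) =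
      (pr₂.left ≫ q.left).appLE V _ kRW r := fun r => appLE_appLE pr₂.left q.left le_rfl kWp r
  have hπ₁₂c : ∀ r : Γ(Q.left, V), e₁₂.left.appLE _ _ k₁₂ ((pr₂.left ≫ q.left).appLE V _ kRW r) =
      (e₁₂.left ≫ pr₂.left ≫ q.left).appLE V _ kR₃ r := fun r => appLE_appLE e₁₂.left (pr₂.left ≫ q.left) kRW k₁₂ r
  have hπ₁₃c : ∀ r : Γ(Q.left, V), e₁₃.left.appLE _ _ k₁₃ ((pr₂.left ≫ q.left).appLE V _ kRW r) =
      (e₁₂.left ≫ pr₂.left ≫ q.left).appLE V _ kR₃ r := fun r =>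
    (appLE_appLE e₁₃.left (pr₂.left ≫ q.left) kRW k₁₃ r).trans (appLE_congr_apply f₁₃ V _ _ kR₃ r)
  have hπ₂₃c : ∀ r : Γ(Q.left, V), e₂₃.left.appLE _ _ k₂₃ ((pr₂.left ≫ q.left).appLE V _ kRW r) =
      (e₁₂.left ≫ pr₂.left ≫ q.left).appLE V _ kR₃ r := fun r =>
    (appLE_appLE e₂₃.left (pr₂.left ≫ q.left) kRW k₂₃ r).trans (appLE_congr_apply f₂₃ V _ _ kR₃ r)
  have hdc : ∀ r : Γ(Q.left, V), u.left.appLE _ (q.left ⁻¹ᵁ V) hWu ((pr₂.left ≫ q.left).appLE V _ kRW r) =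
      q.left.appLE V (q.left ⁻¹ᵁ V) le_rfl r := fun r =>
    (appLE_appLE u.left (pr₂.left ≫ q.left) kRW hWu r).trans (appLE_congr_apply fu V _ _ le_rfl r)
  -- ### the ring maps as `Γ(V)`-algebra maps
  let ψ₁ : Γ(O.left, q.left ⁻¹ᵁ V) →ₐ[Γ(Q.left, V)] Γ(P.left, act.left ⁻¹ᵁ (q.left ⁻¹ᵁ V) ⊓ pr₂.left ⁻¹ᵁ (q.left ⁻¹ᵁ V)) :=
    { toRingHom := (act.left.appLE (q.left ⁻¹ᵁ V) _ kWa).hom, commutes' := hψ₁c }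
  let ψ₂ : Γ(O.left, q.left ⁻¹ᵁ V) →ₐ[Γ(Q.left, V)] Γ(P.left, act.left ⁻¹ᵁ (q.left ⁻¹ᵁ V) ⊓ pr₂.left ⁻¹ᵁ (q.left ⁻¹ᵁ V)) :=
    { toRingHom := (pr₂.left.appLE (q.left ⁻¹ᵁ V) _ kWp).hom, commutes' := hψ₂c }
  let π₁₂ : Γ(P.left, act.left ⁻¹ᵁ (q.left ⁻¹ᵁ V) ⊓ pr₂.left ⁻¹ᵁ (q.left ⁻¹ᵁ V)) →ₐ[Γ(Q.left, V)]
      Γ(P₃.left, W₃) :=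
    { toRingHom := (e₁₂.left.appLE _ _ k₁₂).hom, commutes' := hπ₁₂c }
  let π₁₃ : Γ(P.left, act.left ⁻¹ᵁ (q.left ⁻¹ᵁ V) ⊓ pr₂.left ⁻¹ᵁ (q.left ⁻¹ᵁ V)) →ₐ[Γ(Q.left, V)]
      Γ(P₃.left, W₃) :=
    { toRingHom := (e₁₃.left.appLE _ _ k₁₃).hom, commutes' := hπ₁₃c }
  let π₂₃ : Γ(P.left, act.left ⁻¹ᵁ (q.left ⁻¹ᵁ V) ⊓ pr₂.left ⁻¹ᵁ (q.left ⁻¹ᵁ V)) →ₐ[Γ(Q.left, V)]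
      Γ(P₃.left, W₃) :=
    { toRingHom := (e₂₃.left.appLE _ _ k₂₃).hom, commutes' := hπ₂₃c }
  let d : Γ(P.left, act.left ⁻¹ᵁ (q.left ⁻¹ᵁ V) ⊓ pr₂.left ⁻¹ᵁ (q.left ⁻¹ᵁ V)) →ₐ[Γ(Q.left, V)] Γ(O.left, q.left ⁻¹ᵁ V) :=
    { toRingHom := (u.left.appLE _ (q.left ⁻¹ᵁ V) hWu).hom, commutes' := hdc }
  -- ### the module maps
  let j₁ : Γ(E, q.left ⁻¹ᵁ V) →ₗ[Γ(Q.left, V)]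
      Γ((Scheme.Modules.pullback act.left).obj E, act.left ⁻¹ᵁ (q.left ⁻¹ᵁ V) ⊓ pr₂.left ⁻¹ᵁ (q.left ⁻¹ᵁ V)) :=
    { toFun := unitSectionLE act.left E kWa
      map_add' := unitSectionLE_add act.left E kWa
      map_smul' := fun r x => (unitSectionLE_smul act.left E kWa _ x).trans
        (congrArg (· • unitSectionLE act.left E kWa x) (hψ₁c r)) }
  let j₂ : Γ(E, q.left ⁻¹ᵁ V) →ₗ[Γ(Q.left, V)]
      Γ((Scheme.Modules.pullback pr₂.left).obj E, act.left ⁻¹ᵁ (q.left ⁻¹ᵁ V) ⊓ pr₂.left ⁻¹ᵁ (q.left ⁻¹ᵁ V)) :=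
    { toFun := unitSectionLE pr₂.left E kWp
      map_add' := unitSectionLE_add pr₂.left E kWp
      map_smul' := fun r x => (unitSectionLE_smul pr₂.left E kWp _ x).trans
        (congrArg (· • unitSectionLE pr₂.left E kWp x) (hψ₂c r)) }
  let ΦW : Γ((Scheme.Modules.pullback act.left).obj E, act.left ⁻¹ᵁ (q.left ⁻¹ᵁ V) ⊓ pr₂.left ⁻¹ᵁ (q.left ⁻¹ᵁ V))
      →ₗ[Γ(P.left, act.left ⁻¹ᵁ (q.left ⁻¹ᵁ V) ⊓ pr₂.left ⁻¹ᵁ (q.left ⁻¹ᵁ V))]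
      Γ((Scheme.Modules.pullback pr₂.left).obj E, act.left ⁻¹ᵁ (q.left ⁻¹ᵁ V) ⊓ pr₂.left ⁻¹ᵁ (q.left ⁻¹ᵁ V)) :=
    { toFun := fun y => Φ.app _ y
      map_add' := fun y y' => map_add _ y y'
      map_smul' := fun c y => Scheme.Modules.Hom.app_smul Φ c y }
  let ε : Γ((Scheme.Modules.pullback pr₂.left).obj E, act.left ⁻¹ᵁ (q.left ⁻¹ᵁ V) ⊓ pr₂.left ⁻¹ᵁ (q.left ⁻¹ᵁ V)) →ₗ[Γ(Q.left, V)]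
      Γ(E, q.left ⁻¹ᵁ V) :=
    { toFun := fun y => (sectionPullbackIso hu₂ E).hom.app (q.left ⁻¹ᵁ V)
        (unitSectionLE u.left ((Scheme.Modules.pullback pr₂.left).obj E) hWu y)
      map_add' := counitSection_add act pr₂ u hu₂ (q.left ⁻¹ᵁ V) hWu E
      map_smul' := fun r y => (counitSection_smul act pr₂ u hu₂ (q.left ⁻¹ᵁ V) hWu E _ y).trans
        (congrArg (· • (sectionPullbackIso hu₂ E).hom.app (q.left ⁻¹ᵁ V)
          (unitSectionLE u.left ((Scheme.Modules.pullback pr₂.left).obj E) hWu y)) (hdc r)) }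
  let t₂ : Γ((Scheme.Modules.pullback pr₂.left).obj E, act.left ⁻¹ᵁ (q.left ⁻¹ᵁ V) ⊓ pr₂.left ⁻¹ᵁ (q.left ⁻¹ᵁ V)) →ₗ[Γ(Q.left, V)]
      Γ((Scheme.Modules.pullback e₁₂.left).obj ((Scheme.Modules.pullback pr₂.left).obj E),
        W₃) :=
    { toFun := unitSectionLE e₁₂.left _ k₁₂
      map_add' := unitSectionLE_add e₁₂.left _ k₁₂
      map_smul' := fun r y => (unitSectionLE_smul e₁₂.left _ k₁₂ _ y).trans
        (congrArg (· • unitSectionLE e₁₂.left ((Scheme.Modules.pullback pr₂.left).obj E) k₁₂ y) (hπ₁₂c r)) }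
  let t₃ : Γ((Scheme.Modules.pullback pr₂.left).obj E, act.left ⁻¹ᵁ (q.left ⁻¹ᵁ V) ⊓ pr₂.left ⁻¹ᵁ (q.left ⁻¹ᵁ V)) →ₗ[Γ(Q.left, V)]
      Γ((Scheme.Modules.pullback e₁₃.left).obj ((Scheme.Modules.pullback pr₂.left).obj E),
        W₃) :=
    { toFun := unitSectionLE e₁₃.left _ k₁₃
      map_add' := unitSectionLE_add e₁₃.left _ k₁₃
      map_smul' := fun r y => (unitSectionLE_smul e₁₃.left _ k₁₃ _ y).trans
        (congrArg (· • unitSectionLE e₁₃.left ((Scheme.Modules.pullback pr₂.left).obj E) k₁₃ y) (hπ₁₃c r)) }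
  let t₃' : Γ((Scheme.Modules.pullback pr₂.left).obj E, act.left ⁻¹ᵁ (q.left ⁻¹ᵁ V) ⊓ pr₂.left ⁻¹ᵁ (q.left ⁻¹ᵁ V)) →ₗ[Γ(Q.left, V)]
      Γ((Scheme.Modules.pullback e₁₃.left).obj ((Scheme.Modules.pullback pr₂.left).obj E),
        W₃) :=
    { toFun := fun y => (squareIso h₃ E).hom.app _ (unitSectionLE e₂₃.left ((Scheme.Modules.pullback pr₂.left).obj E) k₂₃ y)
      map_add' := fun y y' => (congrArg ((squareIso h₃ E).hom.app _)
        (unitSectionLE_add e₂₃.left ((Scheme.Modules.pullback pr₂.left).obj E) k₂₃ y y')).trans (map_add _ _ _)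
      map_smul' := fun r y => (cotransition₂₃_smul e₁₃ e₂₃ pr₂ E h₃ k₂₃ _ y).trans
        (congrArg (· • (squareIso h₃ E).hom.app _ (unitSectionLE e₂₃.left ((Scheme.Modules.pullback pr₂.left).obj E) k₂₃ y))
          (hπ₂₃c r)) }
  let Φ₂₃ : Γ((Scheme.Modules.pullback e₁₂.left).obj ((Scheme.Modules.pullback pr₂.left).obj E),
        W₃)
      →ₗ[Γ(P₃.left, W₃)]
      Γ((Scheme.Modules.pullback e₁₃.left).obj ((Scheme.Modules.pullback pr₂.left).obj E),
        W₃) :=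
    { toFun := fun z => (squareIso h₃ E).hom.app _ (((Scheme.Modules.pullback e₂₃.left).map Φ).app _ ((squareIso h₂ E).hom.app _ z))
      map_add' := fun z z' => by rw [map_add, map_add, map_add]
      map_smul' := fun c z => transfer₂₃_smul e₁₂ e₁₃ e₂₃ act pr₂ E Φ h₂ h₃ c z }
  -- ### the hypotheses of the ring head
  -- `Γ(W) ≅ Γ(U) ⊗ Γ(U)`
  obtain ⟨e₂, he₂a, he₂b⟩ := exists_ringEquiv_tensorProduct_chart act pr₂ q hsq hV hU
  have hlift₂ : ∀ x, Algebra.TensorProduct.lift ψ₁ ψ₂ (fun _ _ => Commute.all _ _) x = e₂ x := by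
    intro x
    induction x using TensorProduct.induction_on with
    | zero => simp
    | tmul a b =>
        have hab : a ⊗ₜ[Γ(Q.left, V)] b = (a ⊗ₜ[Γ(Q.left, V)] 1) * (1 ⊗ₜ[Γ(Q.left, V)] b) := by
          rw [Algebra.TensorProduct.tmul_mul_tmul, mul_one, one_mul]
        rw [Algebra.TensorProduct.lift_tmul, hab, map_mul, he₂a, he₂b]
        rfl
    | add x y hx hy => rw [map_add, map_add, hx, hy]
  have hψ : Function.Bijective (Algebra.TensorProduct.lift ψ₁ ψ₂ (fun _ _ => Commute.all _ _)) := by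
    rw [show ⇑(Algebra.TensorProduct.lift ψ₁ ψ₂ (fun _ _ => Commute.all _ _)) = ⇑e₂ from funext hlift₂]
    exact e₂.bijective
  -- `Γ(W₃) ≅ Γ(U) ⊗ Γ(U) ⊗ Γ(U)`
  obtain ⟨e₃, he₃a, he₃c⟩ := exists_ringEquiv_tensorProduct_triple e₁₂ e₂₃ act pr₂ q hsq hsq₃ hV hU hW le_rfl kWp hW₃eq
  have he₃a' : ∀ c : Γ(O.left, q.left ⁻¹ᵁ V), e₃ (c ⊗ₜ 1) = π₁₃ (ψ₂ c) := by
    intro c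
    rw [he₃a]
    change (e₂₃.left ≫ pr₂.left).appLE _ _ _ c = e₁₃.left.appLE _ _ k₁₃ (pr₂.left.appLE _ _ kWp c)
    rw [appLE_appLE, appLE_congr_apply h₃.symm]
  have hlift₃ := bijective_lift_lift_of_ringEquiv ψ₁ ψ₂ π₁₂ π₁₃ hψ e₃ he₃a' (fun w => he₃c w)
  -- the range of `j` in the chart form
  have hj' : ∀ s : Γ(E, q.left ⁻¹ᵁ V), s ∈ Set.range j ↔ ΦW (j₁ s) = j₂ s := by
    intro s
    rw [hj s]
    change _ ↔ Φ.app _ (unitSectionLE act.left E kWa s) = unitSectionLE pr₂.left E kWp s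
    rw [unitSectionLE, unitSectionLE, app_presheaf_map]
  exact ModuleDescentData.isBaseChange_of_range_eq_of_isBaseChange ψ₁ ψ₂ π₁₂ π₁₃ π₂₃ d j₁ j₂ ΦW ε t₂ t₃ t₃' Φ₂₃ hψ
    (fun s x => unitSectionLE_smul act.left E kWa s x) (fun s x => unitSectionLE_smul pr₂.left E kWp s x)
    (isBaseChange_snd act pr₂ q E hU hW (V := V))
    (fun s => appLE_section_appLE_act act pr₂ u hu₁ (q.left ⁻¹ᵁ V) hWu s)
    (fun s y => counitSection_smul act pr₂ u hu₂ (q.left ⁻¹ᵁ V) hWu E s y)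
    (fun x => counitSection_unitSectionLE_snd act pr₂ u hu₂ (q.left ⁻¹ᵁ V) hWu E x)
    (fun x => counitSection_app_unitSectionLE_act act pr₂ u hu₁ hu₂ (q.left ⁻¹ᵁ V) hWu E Φ hunit x)
    (fun s => appLE₁₃_appLE_act e₁₂ e₁₃ act h₁ kWa k₁₂ k₁₃ s)
    (fun s => appLE₂₃_appLE_act e₁₂ e₂₃ act pr₂ h₂ kWa kWp k₁₂ k₂₃ s)
    (fun s y => transition₁₂_smul e₁₂ pr₂ E k₁₂ s y) (fun s y => transition₁₃_smul e₁₃ pr₂ E k₁₃ s y)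
    (fun s y => cotransition₂₃_smul e₁₃ e₂₃ pr₂ E h₃ k₂₃ s y)
    (fun x => transition₁₃_unitSectionLE e₁₃ e₂₃ pr₂ E h₃ kWp k₁₃ k₂₃ x)
    (fun x => transfer₂₃_transition₁₂_unitSectionLE e₁₂ e₁₃ e₂₃ act pr₂ E Φ h₂ h₃ kWa kWp k₁₂ k₂₃ x)
    (fun x => transition₁₃_coface_eq_of_cocycle e₁₂ e₁₃ e₂₃ act pr₂ E Φ h₁ h₂ h₃ hcoc kWa k₁₂ k₁₃ x)
    hlift₃ (isBaseChange_transition₁₃ e₁₃ pr₂ E k₁₃ hW hW₃a) j hjinj hj'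

/-- **THE JOINT HEAD (effective descent of modules, one affine chart of an fppf torsor quotient).**  Let `q : O → Q` be flat and
surjective with torsor square `hsq : P ≅ O ×_Q O` (legs `act`, `pr₂`), triple `e₁₂ e₁₃ e₂₃ : P₃ → P` with `hsq₃ : P₃ ≅ P ×_{pr₂, O, act} P` and
faces `h₁ h₂ h₃`, unit slice `u : O → P` (`u ≫ act = 𝟙 = u ≫ pr₂`), `E` quasi-coherent on `O` with a descent datum `Φ : act^*E ⟶ pr₂^*E` satisfying the
UNIT (`u^*Φ = can ≫ can⁻¹`, ★ `Linearisation.iso_unit_hom` shape) and the COCYCLE (`e₁₃^*Φ = can ≫ e₁₂^*Φ ≫ can ≫ e₂₃^*Φ ≫ can`, ★ `Linearisation.iso_mul_hom`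
shape).  Then for every affine `V ⊆ Q` with `U := q⁻¹V` affine, ANY injective `Γ(V)`-linear `j : N → Γ(U, E)` whose range is exactly the set of sections
`s` with `Φ(η_act s)|_W = η_pr₂(s)|_W` on `W = act⁻¹U ⊓ pr₂⁻¹U` (the coinvariant sections, ★ `SchemeEquivariant.mem_range_moduleCoinvariantsι_app_iff_inf`)
exhibits `Γ(U, E)` as the BASE CHANGE `Γ(U) ⊗_{Γ(V)} N` — the hypothesis `hbc` of ★ `SchemeEquivariant.descentHom_app_bijective_of_isBaseChange`.
Proof: ★ `ModuleDescentData.isBaseChange_of_range_eq_of_isBaseChange` fed with PART 1 (degree one), ★ `TorsorQuotientModuleChartUnit` (counit) and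
§2–§5 (cocycle over the triple chart). [cite: SGA1, Exp. VIII §1, Thm. 1.1] [cite: StacksProject, Tag 023N] [cite: GortzWedhorn2020, Thm. 14.68] [cite: MumfordAV1970, §12 Thm. 1 (B) (p. 112)] -/
theorem isBaseChange_of_range_eq_equaliser [Flat q.left] [Surjective q.left] [E.IsQuasicoherent]
    (hsq : IsPullback act.left pr₂.left q.left q.left) (hsq₃ : IsPullback e₁₂.left e₂₃.left pr₂.left act.left)
    (h₁ : e₁₃.left ≫ act.left = e₁₂.left ≫ act.left) (h₂ : e₁₂.left ≫ pr₂.left = e₂₃.left ≫ act.left)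
    (h₃ : e₂₃.left ≫ pr₂.left = e₁₃.left ≫ pr₂.left)
    (hcoc : (Scheme.Modules.pullback e₁₃.left).map Φ =
      (squareIso h₁ E).hom ≫ (Scheme.Modules.pullback e₁₂.left).map Φ ≫ (squareIso h₂ E).hom ≫
        (Scheme.Modules.pullback e₂₃.left).map Φ ≫ (squareIso h₃ E).hom)
    (u : O ⟶ P) (hu₁ : u.left ≫ act.left = 𝟙 O.left) (hu₂ : u.left ≫ pr₂.left = 𝟙 O.left)
    (hunit : (Scheme.Modules.pullback u.left).map Φ = (sectionPullbackIso hu₁ E).hom ≫ (sectionPullbackIso hu₂ E).inv)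
    (hV : IsAffineOpen V) (hU : IsAffineOpen (q.left ⁻¹ᵁ V))
    {N : Type u} [AddCommGroup N] [Module Γ(Q.left, V) N]
    (j : letI : Module Γ(Q.left, V) Γ(E, q.left ⁻¹ᵁ V) := Module.compHom _ (q.left.appLE V (q.left ⁻¹ᵁ V) le_rfl).hom
      N →ₗ[Γ(Q.left, V)] Γ(E, q.left ⁻¹ᵁ V))
    (hjinj : Function.Injective j)
    (hj : ∀ s : Γ(E, q.left ⁻¹ᵁ V), s ∈ Set.range j ↔
      ((Scheme.Modules.pullback pr₂.left).obj E).presheaf.map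
          (homOfLE (inf_le_left : act.left ⁻¹ᵁ (q.left ⁻¹ᵁ V) ⊓ pr₂.left ⁻¹ᵁ (q.left ⁻¹ᵁ V) ≤ act.left ⁻¹ᵁ (q.left ⁻¹ᵁ V))).op
          (Φ.app (act.left ⁻¹ᵁ (q.left ⁻¹ᵁ V)) (unitSection act.left E (q.left ⁻¹ᵁ V) s)) =
        ((Scheme.Modules.pullback pr₂.left).obj E).presheaf.map
          (homOfLE (inf_le_right : act.left ⁻¹ᵁ (q.left ⁻¹ᵁ V) ⊓ pr₂.left ⁻¹ᵁ (q.left ⁻¹ᵁ V) ≤ pr₂.left ⁻¹ᵁ (q.left ⁻¹ᵁ V))).op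
          (unitSection pr₂.left E (q.left ⁻¹ᵁ V) s)) :
    letI := (q.left.appLE V (q.left ⁻¹ᵁ V) le_rfl).hom.toAlgebra
    letI : Module Γ(Q.left, V) Γ(E, q.left ⁻¹ᵁ V) := Module.compHom _ (q.left.appLE V (q.left ⁻¹ᵁ V) le_rfl).hom
    haveI : IsScalarTower Γ(Q.left, V) Γ(O.left, q.left ⁻¹ᵁ V) Γ(E, q.left ⁻¹ᵁ V) :=
      ⟨fun a b x => mul_smul ((q.left.appLE V (q.left ⁻¹ᵁ V) le_rfl).hom a) b x⟩
    IsBaseChange Γ(O.left, q.left ⁻¹ᵁ V) j :=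
  isBaseChange_of_range_eq_equaliser_of_eq e₁₂ e₁₃ e₂₃ act pr₂ q E Φ hsq hsq₃ h₁ h₂ h₃ hcoc u hu₁ hu₂ hunit hV hU rfl j hjinj hj

end TorsorQuotient

end Literature.AlgebraicGeometry.RelativeSpec

end
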